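import Mathlib.Algebra.Field.ZMod
import Mathlib.LinearAlgebra.FiniteDimensional.Lemmas
import Mathlib.LinearAlgebra.LinearIndependent.Lemmas
import Summits.MatrixMultiplication.OmegaCensus.SmallFormats.GF2MatrixBits
import HarnessLib

/-!
# ω-census family (a), GF(2) rank floors: an executable linear-independence check and the test-matrix bound

Cell `pub-omega` (unit `pub-omega-lit`, gen 4), topic `Summits/MatrixMultiplication/OmegaCensus` (sub-folder
`SmallFormats`). Framing (verbatim): lottery ticket; floor = certified bounds/negative ranges. HONEST FRAMING:
replay infrastructure (design note `pub-omega-lit/KERNEL-GF2-FLOORS-DESIGN.md` §7, layer R1), nothing here is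
progress on `ω`. PROVED here, no facts:

* `allXors`, `indepB` — over `𝔽₂` the span of bit rows is the set of their subset-`xor`s, so a list of rows is
  linearly independent iff no row is a subset-`xor` of the later ones; `linearIndependent_vecOf_of_indepB`.
* `le_finrank_range_of_linearIndependent_test` — for a bilinear `ψ : S × V → W`, elements `u_i ∈ S` and test
  data `(v_t, e_t)`: if the rows `t ↦ e_t(ψ(u_i, v_t))` are linearly independent then `r ≤ dim range ψ`
  (the flattening rank read off a finite test matrix). With `le_finrank_range_of_indepB` the hypothesis is a
  Boolean computation on bit rows.
-/

namespace Summit.MatrixMultiplication.OmegaCensus.GF2RankLB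

open Module

/-! ## Subset xors and the independence check -/

/-- All subset-`xor`s of a list (the empty subset first). -/
def allXors : List ℕ → List ℕ
  | [] => [0]
  | a :: L => allXors L ++ (allXors L).map (fun s => a ^^^ s)

/-- Executable independence check for bit rows over `𝔽₂`: no row is a subset-`xor` of the later rows. -/
def indepB : List ℕ → Bool
  | [] => true
  | a :: L => indepB L && (allXors L).all (fun s => !(s == a))

/-- Elements of `allXors` of rows below `2 ^ N` are below `2 ^ N`. -/
theorem allXors_lt {N : ℕ} : ∀ (L : List ℕ), (∀ a ∈ L, a < 2 ^ N) → ∀ s ∈ allXors L, s < 2 ^ N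
  | [], _, s, hs => by
    simp only [allXors, List.mem_singleton] at hs
    subst hs
    exact Nat.two_pow_pos N
  | a :: L, hL, s, hs => by
    simp only [allXors, List.mem_append, List.mem_map] at hs
    have hL' : ∀ b ∈ L, b < 2 ^ N := fun b hb => hL b (List.mem_cons_of_mem a hb)
    rcases hs with hs | ⟨s', hs', rfl⟩
    · exact allXors_lt L hL' s hs
    · exact Nat.xor_lt_two_pow (hL a List.mem_cons_self) (allXors_lt L hL' s' hs')

/-- The bit rows of a list as vectors over `𝔽₂`. -/
def rowVec (N : ℕ) (L : List ℕ) : Fin L.length → (Fin N → ZMod 2) := fun i => vecOf N (L.get i)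

/-- `vecOf N 0 = 0`. -/
theorem vecOf_zero (N : ℕ) : vecOf N 0 = 0 := by
  funext t
  simp [vecOf]

/-- The range of the rows of `a :: L`. -/
theorem range_rowVec_cons (N a : ℕ) (L : List ℕ) :
    Set.range (rowVec N (a :: L)) = insert (vecOf N a) (Set.range (rowVec N L)) := by
  ext y
  simp only [Set.mem_range, Set.mem_insert_iff]
  constructor
  · rintro ⟨i, rfl⟩
    refine Fin.cases (Or.inl rfl) (fun j => Or.inr ⟨j, rfl⟩) i
  · rintro (rfl | ⟨j, rfl⟩)
    · exact ⟨0, rfl⟩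
    · exact ⟨j.succ, rfl⟩

/-- Over `𝔽₂`, the span of bit rows consists of their subset-`xor`s. -/
theorem exists_allXors_of_mem_span (N : ℕ) : ∀ (L : List ℕ),
    ∀ y ∈ Submodule.span (ZMod 2) (Set.range (rowVec N L)), ∃ s ∈ allXors L, y = vecOf N s
  | [], y, hy => by
    haveI : IsEmpty (Fin ([] : List ℕ).length) := inferInstanceAs (IsEmpty (Fin 0))
    have he : Set.range (rowVec N []) = ∅ := Set.range_eq_empty _
    rw [he, Submodule.span_empty, Submodule.mem_bot] at hy
    exact ⟨0, by simp [allXors], by rw [hy, vecOf_zero]⟩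
  | a :: L, y, hy => by
    rw [range_rowVec_cons, Submodule.mem_span_insert] at hy
    obtain ⟨c, z, hz, rfl⟩ := hy
    obtain ⟨s, hs, rfl⟩ := exists_allXors_of_mem_span N L z hz
    have hc : c = 0 ∨ c = 1 := by
      fin_cases c
      · exact Or.inl rfl
      · exact Or.inr rfl
    rcases hc with rfl | rfl
    · exact ⟨s, by simp [allXors, hs], by rw [zero_smul, zero_add]⟩
    · exact ⟨a ^^^ s, by simp [allXors, hs], by rw [one_smul, vecOf_xor]⟩

/-- Soundness of `indepB` (list form). -/
theorem linearIndependent_rowVec (N : ℕ) : ∀ (L : List ℕ), (∀ a ∈ L, a < 2 ^ N) →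
    indepB L = true → LinearIndependent (ZMod 2) (rowVec N L)
  | [], _, _ => by
    haveI : IsEmpty (Fin ([] : List ℕ).length) := inferInstanceAs (IsEmpty (Fin 0))
    exact linearIndependent_empty_type
  | a :: L, hL, h => by
    simp only [indepB, Bool.and_eq_true, List.all_eq_true, Bool.not_eq_true'] at h
    obtain ⟨h1, h2⟩ := h
    have hL' : ∀ b ∈ L, b < 2 ^ N := fun b hb => hL b (List.mem_cons_of_mem a hb)
    have ih := linearIndependent_rowVec N L hL' h1
    have e : rowVec N (a :: L) = Fin.cons (vecOf N a) (rowVec N L) := by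
      funext i
      refine Fin.cases ?_ (fun j => ?_) i
      · simp [rowVec]
      · simp [rowVec]
    rw [e]
    refine linearIndependent_finCons.mpr ⟨ih, fun hmem => ?_⟩
    obtain ⟨s, hs, hvs⟩ := exists_allXors_of_mem_span N L _ hmem
    have has : a = s :=
      eq_of_vecOf_eq (hL a List.mem_cons_self) (allXors_lt L hL' s hs) hvs
    have := h2 s hs
    rw [has] at this
    simp at this

/-- Soundness of `indepB` (function form): independent bit rows give independent vectors. -/
theorem linearIndependent_vecOf_of_indepB {r N : ℕ} (rows : Fin r → ℕ) (hlt : ∀ i, rows i < 2 ^ N)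
    (h : indepB (List.ofFn rows) = true) :
    LinearIndependent (ZMod 2) (fun i => vecOf N (rows i)) := by
  have hmem : ∀ a ∈ List.ofFn rows, a < 2 ^ N := by
    intro a ha
    rw [List.mem_ofFn] at ha
    obtain ⟨i, rfl⟩ := ha
    exact hlt i
  have h1 := linearIndependent_rowVec N (List.ofFn rows) hmem h
  let e : Fin (List.ofFn rows).length ≃ Fin r := finCongr (List.length_ofFn)
  have h2 : rowVec N (List.ofFn rows) = (fun i => vecOf N (rows i)) ∘ e := by
    funext j
    simp only [rowVec, Function.comp_apply, List.get_ofFn]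
    rfl
  rw [h2] at h1
  exact (linearIndependent_equiv e).mp h1

/-! ## The test-matrix bound on a flattening rank -/

section TestMatrix

variable {k : Type*} [Field k] {S V W : Type*} [AddCommGroup S] [Module k S] [AddCommGroup V]
  [Module k V] [AddCommGroup W] [Module k W] [FiniteDimensional k V] [FiniteDimensional k W]

/-- **Test-matrix bound.** For a bilinear `ψ : S × V → W`, elements `u_i` (`i < r`) of `S`, test vectors
`v_t ∈ V` and test functionals `e_t ∈ W^*`: if the `r` rows `t ↦ e_t(ψ(u_i, v_t))` are linearly independent,
then the slices `ψ(u_i, ·)` are independent, so `r ≤ dim range ψ` (the first flattening rank). -/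
theorem le_finrank_range_of_linearIndependent_test {r : ℕ} {τ : Type*} [Fintype τ]
    (ψ : S →ₗ[k] V →ₗ[k] W) (u : Fin r → S) (v : τ → V) (e : τ → Module.Dual k W)
    (h : LinearIndependent k (fun i : Fin r => fun t : τ => e t (ψ (u i) (v t)))) :
    r ≤ finrank k (LinearMap.range ψ) := by
  let Λ : (V →ₗ[k] W) →ₗ[k] (τ → k) := LinearMap.pi fun t => (e t).comp (LinearMap.applyₗ (v t))
  let w : Fin r → LinearMap.range ψ := fun i => ⟨ψ (u i), LinearMap.mem_range_self ψ (u i)⟩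
  have hcomp : (Λ.comp (LinearMap.range ψ).subtype) ∘ w
      = fun i : Fin r => fun t : τ => e t (ψ (u i) (v t)) := by
    funext i t
    simp [Λ, w]
  have hw : LinearIndependent k w := by
    apply LinearIndependent.of_comp (Λ.comp (LinearMap.range ψ).subtype)
    rw [hcomp]
    exact h
  simpa using hw.fintype_card_le_finrank

end TestMatrix

section TestMatrixGF2

variable {S V W : Type*} [AddCommGroup S] [Module (ZMod 2) S] [AddCommGroup V]
  [Module (ZMod 2) V] [AddCommGroup W] [Module (ZMod 2) W] [FiniteDimensional (ZMod 2) V]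
  [FiniteDimensional (ZMod 2) W]

/-- The test-matrix bound with a Boolean hypothesis: if the entries `e_t(ψ(u_i, v_t))` are the bits
`entry i t` and the bit rows pass `indepB`, then `r ≤ dim range ψ`. -/
theorem le_finrank_range_of_indepB {r C : ℕ} (ψ : S →ₗ[ZMod 2] V →ₗ[ZMod 2] W)
    (u : Fin r → S) (v : Fin C → V) (e : Fin C → Module.Dual (ZMod 2) W) (entry : ℕ → ℕ → Bool)
    (hentry : ∀ (i : Fin r) (t : Fin C), e t (ψ (u i) (v t)) = if entry i t then 1 else 0)
    (hind : indepB (List.ofFn fun i : Fin r => maskOf (entry i) C) = true) :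
    r ≤ finrank (ZMod 2) (LinearMap.range ψ) := by
  apply le_finrank_range_of_linearIndependent_test ψ u v e
  have h1 := linearIndependent_vecOf_of_indepB (N := C) (fun i : Fin r => maskOf (entry i) C)
    (fun i => maskOf_lt _ _) hind
  convert h1 using 2 with i
  funext t
  rw [hentry]
  simp [vecOf, testBit_maskOf, t.2]

end TestMatrixGF2

end Summit.MatrixMultiplication.OmegaCensus.GF2RankLB
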